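import Summits.BirchSwinnertonDyer.Rank1Residual.Additive.X4RankZeroUpperBound
import Summits.BirchSwinnertonDyer.Rank1Residual.X4.KuriharaClasswide
import HarnessLib
import HarnessLib.Audit.Tags

/-!
# N11 — "Kim 2026 Thm. 1.8 (6) at `p = 3`" TYPED IN KIM'S OWN BINDER SHAPE (cell `b2b-bsdres`,
# team n1011, seat p03, OWNERS row T-a2; STATEMENTS — two per-pair predicates, four conjectures)

HONEST FRAMING (cell `b2b-bsdres`, run/shared/lean/b2b/bsd-rank1-residual/, verbatim in every
file): the goal of the cell is to DELETE the COMBINATION-SHAPED residual classes of the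
Birch–Swinnerton-Dyer formula for ALL analytic-rank `≤ 1` elliptic curves over `ℚ` — "full BSD
formula for every rank `≤ 1` curve in class `C`" assembled STRICTLY from published theorems — so
that the rank-`≤ 1` remainder becomes exactly the CONSTRUCTION-SHAPED classes, which are TYPED
(missing-input `Prop`s), NOT attempted. This is not "finishing BSD". Team n1011 (N10 / N11, the
additive block at `p = 3`): prove what is provable now; shrink each hard class to its core with
data; no claim beyond stated classes. Research routes; census output = EVIDENCE / conjecture items,
never a Literature fact. The label X4 is UNCHANGED by this file; nothing is booked; NOTHING below
is asserted — `def … : Prop` only, plus bookkeeping theorems whose every published input is an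
explicit named-fact hypothesis.

## What this file types (RESIDUAL-MAP §I N11; CLASS-CLOSURE-PLAN §3.1 route (a); REFEREE-1 R3)

N11 = X4 ∧ `r_an = 0` ∧ `p = 3` ∧ surj(3): "Kim 2026 Thm. 1.8 (6) at `p = 3`" — the one printed
hypothesis `p ≥ 5` of C.-H. Kim, Amer. J. Math. 148 (2026) Thm. 1.8 (= arXiv:2203.12159v4 Thm. 1.9)
binds ALONE on the largest block of the residue. The cell's existing conjecture
`Additive.X4SharpThree` (`SharpenedStatements.lean` l. 240) states the CONSEQUENCE of Kim's
clause (6) in the census currency (`ord₃ #Ш ≤ ord₃ #Ш_an + ord₃ ∏ c_ℓ`, all surj(3) rows). Here the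
hypothesis is typed in KIM'S OWN BINDER SHAPE — the tree's named facts
`Kim2026.rankZero_padicValNat_sha_le_of_maninConstant` (clause (6), inequality, certificate-free)
and `Kim2022_rankZero_padicValRat_sha_of_kuriharaNumber_ne_zero_of_maninConstant` (clauses (1)+(6),
EQUALITY at a unit Kurihara number) with `5 ≤ p` REPLACED and ONE binder ADDED:

* `KimRankZeroBoundAt W p` / `KimRankZeroUnitBoundAt W p` — the two per-PAIR predicates "clause (6)
  holds at `(E, p)`" in exactly those binder shapes, with the `3`-adic replacement of Serre's
  "surj(p) ⇒ `ρ_{E,p^∞}` onto" (automatic at `p ≥ 5`, FALSE at `3`: Elkies' `9`-deficient curves)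
  carried as the EXPLICIT tower binder `∀ n, ρ̄_{E,p^n}` onto — the binder under which Kato's
  (12.5.2) holds at `3` and the cell's census certifies `3`-adic surjectivity (SURJ9 / `j`-witness;
  RESIDUAL-MAP §D addendum 5: decided on 100 % of X4@3);
* `KimThree` / `KimThreeUnit` — "Kim's Thm. 1.8 (6) / (1)+(6) remain valid at `p = 3`" for EVERY
  `E/ℚ` (no reduction binder, as printed: Kim §1.2.5 "the `p ≥ 5` condition is required only for
  the Chebotarev density type argument in [Mazur–Rubin], and it seems possible to extend to the
  `p = 3` case following the recent work of Sakamoto" — Mazur–Rubin hypothesis (H.4) `p > 4`, which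
  fails for `T_3 E` because `E[3] ≅ E[3]^∨(1)`; Sakamoto, Doc. Math. 27 (2022) App. §5 rebuilds the
  Kolyvagin-system rigidity at `p = 3` for residually self-dual `T`). PRINTED REASON (referee-1 RA3,
  2026-08-21): the statement is ANNOUNCED — C.-H. Kim (appendix by R. Pollack), *The refined Tamagawa
  number conjectures for GL₂*, arXiv:2505.09121v1 (2025), Thm. 1.1 / Thm. 1.2 / Cor. 1.7 (`p ≥ 3`,
  LARGE IMAGE `ρ_f(G_{ℚ(μ_{p^∞})}) ⊇ SL₂(ℤ_p)` ⟸ the tower binder, any level; §3.2.2 / Prop. 3.4 for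
  `p = 3`), resting on R. Sakamoto, *The theory of Kolyvagin systems for p = 3*, J. Théor. Nombres
  Bordeaux 36 (2024) 919–946 (REFEREED) — a PREPRINT, cited here only as the reason these OPEN
  conjectures are stated (flag `Kim2025-preprint`); its typing as a labelled-OPEN Literature fact in
  its own minimal-period currency is OWNERS row T-a4, and the bridge lemma `KimThree ⟸ that fact`
  (modulo the Ω_E-integrality of the modular symbols, Kim 2026 §1.4.1) is owed here on its landing;
* `X4SharpThreeKim` / `X4SharpThreeKimUnit` — the same RESTRICTED to an additive `3` (`Addv W 3`):
  THE N11 HYPOTHESIS in Kim's binder shape (`x4SharpThreeKim_of_kimThree`).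

Sanity (STEP-0 in the kernel): at `5 ≤ p` both per-pair predicates ARE the tree's Kim facts
(`kimRankZeroBoundAt_of_five_le`, `kimRankZeroUnitBoundAt_of_five_le`). The binder-by-binder
comparison with `Additive.X4SharpThree`, the consistency with every kernel-closed N11 row, the
falsifiable census prediction on the Tamagawa-obstructed rows and the NEW per-pair lever on the
LOWER rows (`3 ∣ #Ш_an`: ONE unit Kurihara number at `3` closes the pair modulo `X4SharpThreeKimUnit`)
are the sibling file `Additive/X4SharpThreeKimShapeConsequences.lean`.

EVIDENCE / census protocol (CLASS-CLOSURE-PLAN §1, §3.1 E1; team file cells/n1011/skel/T-a2.md): the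
unit form predicts, on every N11 row where `BSD₃` is a kernel theorem and `3 ∣ ∏ c_ℓ` (the 16 690
parity-closed Tamagawa-defect rows of additive-p4 V23/V24), that NO cyclic-level Kurihara number at `3`
is a unit; held-out rows (LOWER / TAM-DEFECT₂♭) are predictions, never fits. Nothing asserted.

References: C.-H. Kim, Amer. J. Math. 148 (2026) 79–129 = arXiv:2203.12159v4, Thm. 1.9 (1), (6),
§1.2.5, §1.3.5, §1.4.1–1.4.4, §1.5.1, Conj. 1.10 [Kim2022StructureSelmer]; R. Sakamoto, Doc. Math. 27
(2022) 1891–1922, App. §5 (Remarks on `p = 3`), Lemma 5.2, Thm. 5.13, Prop. 5.15, Thm. 5.16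
[Sakamoto2022pSelmer]; B. Mazur, K. Rubin, *Kolyvagin systems*, Mem. AMS 799 (2004) §3.5 (H.4);
N. Elkies, arXiv:math/0612734 (`3`-adic images); J.-P. Serre, *Abelian ℓ-adic representations* IV §3.4;
Miller 2011 Def. 1.1 [Miller2011LMS].
-/

noncomputable section

open scoped Classical MatrixGroups ModularForm

open CongruenceSubgroup WeierstrassCurve Literature.NumberTheory.EllipticCurves
  Literature.NumberTheory.EllipticCurves.ModularForms
  Literature.NumberTheory.EllipticCurves.Rank1Residual
  Literature.NumberTheory.EllipticCurves.Rank1Residual.Typed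

namespace Summit.BirchSwinnertonDyer.Rank1Residual.Additive

/-! ## §1 The two per-pair predicates (Kim's binder shapes, `5 ≤ p` removed, tower binder added) -/

/-- **Kim's clause (6) at the pair `(E, p)`, certificate-free INEQUALITY shape**: the body of the
tree fact `Kim2026.rankZero_padicValNat_sha_le_of_maninConstant` at `(W, p)` with the binder `5 ≤ p`
REMOVED and the tower binder `∀ n, ρ̄_{E,p^n}` onto ADDED (at `p ≥ 5` a consequence of surj(p),
Serre; at `p = 3` the census certificate SURJ9 / `j`-witness): `ρ̄_{E,p}` onto, tower onto,
`L(E,1) ≠ 0`, `Ш(E/ℚ)` finite, a modular parametrisation datum `D` with `p ∤ c_D` ⟹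
`L(E,1)/Ω(W) = q ∈ ℚ` with `ord_p #Ш(E/ℚ)(p) ≤ ord_p q`. A predicate on `(W, p)`; nothing asserted;
a THEOREM at `5 ≤ p` (`kimRankZeroBoundAt_of_five_le`), the N11 hypothesis at `p = 3`.
[cite: Kim2022StructureSelmer, Thm. 1.9 (6) (PDF p. 8), §1.2.5 (PDF p. 5), §1.3.5, §1.4.1–1.4.4, §1.5.1] -/
@[conjecture] def KimRankZeroBoundAt (W : WeierstrassCurve ℚ) [W.IsElliptic] [W.IsGloballyMinimal] (p : ℕ)
    [Fact p.Prime] : Prop :=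
  W.HasSurjectiveModNGaloisRep p → (∀ n : ℕ, W.HasSurjectiveModNGaloisRep (p ^ n : ℕ)) →
    W.entireLFunction 1 ≠ 0 → Finite W.sha →
    ∀ {N : ℕ} [NeZero N] (D : ModularParametrizationData W N), ¬ (p : ℤ) ∣ D.maninConstant →
    ∃ q : ℚ, W.entireLFunction 1 / (W.realPeriodRat : ℂ) = (q : ℂ) ∧
      (padicValNat p (Nat.card (AddCommGroup.primaryComponent W.sha p)) : ℤ) ≤ padicValRat p q

/-- **Kim's clauses (1)+(6) at the pair `(E, p)`, unit-Kurihara-number EQUALITY shape**: the body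
of the tree fact `Kim2022_rankZero_padicValRat_sha_of_kuriharaNumber_ne_zero_of_maninConstant` at
`(W, p)` with `5 ≤ p` REMOVED and the tower binder ADDED: `ρ̄_{E,p}` onto, tower onto, `L(E,1) ≠ 0`,
`Ш(E/ℚ)` finite, datum `D` with `p ∤ c_D`, period transfer `Ω(W) = u·Ω⁺_{D.f}` with `|u|_p = 1`,
a level `n ∈ 𝒩₁(E,p)` with cyclic reductions `#Ẽ(𝔽_ℓ)[p] ≤ p`, surjective discrete logarithms
`ψ`, ONE unit `kuriharaNumber D.f p n ψ ≠ 0` ⟹ `L(E,1)/Ω(W) = q ∈ ℚ` with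
`ord_p q = ord_p #Ш(E/ℚ)(p)` (BOTH halves of the `p`-part). A predicate on `(W, p)`; nothing
asserted; a THEOREM at `5 ≤ p` (`kimRankZeroUnitBoundAt_of_five_le`).
[cite: Kim2022StructureSelmer, Thm. 1.9 (1) and (6) (PDF pp. 7–8), §1.4.3, Prop. 3.2, Lemma 3.10] -/
@[conjecture] def KimRankZeroUnitBoundAt (W : WeierstrassCurve ℚ) [W.IsElliptic] [W.IsGloballyMinimal] (p : ℕ)
    [Fact p.Prime] : Prop :=
  W.HasSurjectiveModNGaloisRep p → (∀ n : ℕ, W.HasSurjectiveModNGaloisRep (p ^ n : ℕ)) →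
    W.entireLFunction 1 ≠ 0 → Finite W.sha →
    ∀ {N : ℕ} [NeZero N] (D : ModularParametrizationData W N), ¬ (p : ℤ) ∣ D.maninConstant →
    (∃ u : ℚ, ‖(u : ℚ_[p])‖ = 1 ∧ W.realPeriodRat = u * plusPeriod D.f) →
    ∀ (n : ℕ) [NeZero n], Kato.IsKolyvaginProduct W p 1 n →
    (∀ (ℓ : ℕ) [Fact ℓ.Prime], ℓ ∣ n →
      Nat.card {P : ((WeierstrassCurve.integralModelInt W).map
          (Int.castRingHom (ZMod ℓ))).toAffine.Point // p • P = 0} ≤ p) →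
    ∀ ψ : (ℓ : ℕ) → (ZMod ℓ)ˣ →* Multiplicative (ZMod (p ^ 1)),
      (∀ ℓ ∈ n.primeFactors, Function.Surjective (ψ ℓ)) →
      kuriharaNumber D.f (p ^ 1) n ψ ≠ 0 →
    ∃ q : ℚ, W.entireLFunction 1 / (W.realPeriodRat : ℂ) = (q : ℂ) ∧
      padicValRat p q = (padicValNat p (Nat.card (AddCommGroup.primaryComponent W.sha p)) : ℤ)

variable (W : WeierstrassCurve ℚ) [W.IsElliptic] [W.IsGloballyMinimal] (p : ℕ) [Fact p.Prime]

/-- **STEP-0 in the kernel (inequality shape): at `5 ≤ p` the per-pair predicate IS Kim's theorem**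
(tree fact `hKim`; the tower binder is simply not used). [cite: Kim2022StructureSelmer, Thm. 1.9 (6) (PDF p. 8)] -/
theorem kimRankZeroBoundAt_of_five_le (hKim : Kim2026.rankZero_padicValNat_sha_le_of_maninConstant)
    (hp : 5 ≤ p) : KimRankZeroBoundAt W p :=
  fun hsurj _ hL hfin _ _ D hc => hKim W p hp hsurj hL hfin D hc

/-- **STEP-0 in the kernel (unit shape): at `5 ≤ p` the per-pair predicate IS Kim's theorem** (tree
fact `hKim`). [cite: Kim2022StructureSelmer, Thm. 1.9 (1) and (6) (PDF pp. 7–8)] -/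
theorem kimRankZeroUnitBoundAt_of_five_le
    (hKim : Kim2022_rankZero_padicValRat_sha_of_kuriharaNumber_ne_zero_of_maninConstant)
    (hp : 5 ≤ p) : KimRankZeroUnitBoundAt W p :=
  fun hsurj _ hL hfin _ _ D hc hper n _ hn hcyc ψ hψ hδ =>
    hKim W p hp hsurj hL hfin D hc hper n hn hcyc ψ hψ hδ

/-! ## §2 The conjectures at `p = 3` (nothing asserted) -/

/-- **Conjecture `KimThree` — "Kim 2026 Thm. 1.8 (6) remains valid at `p = 3`"** in Kim's binder
shape, for EVERY `E/ℚ` (no reduction binder, as printed), under `3`-adic TOWER surjectivity: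
`∀ W, KimRankZeroBoundAt W 3`. Kim §1.2.5: `p ≥ 5` enters only through Mazur–Rubin's Chebotarev
argument (hypothesis (H.4) `p > 4`); Sakamoto 2022 App. §5 treats `p = 3` for residually self-dual
`T` at a good ordinary `3`. ANNOUNCED (printed reason, PRE, flag `Kim2025-preprint`): Kim–Pollack
arXiv:2505.09121v1 Thm. 1.1 / Cor. 1.7 (`p ≥ 3`, large image), on Sakamoto JTNB 36 (2024) (PUB).
OPEN in the tree; nothing asserted. [cite: Kim2022StructureSelmer, Thm. 1.9 (6), §1.2.5 (PDF p. 5)]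
[cite: Sakamoto2022pSelmer, App. §5 (Remarks on p = 3), Lemma 5.2, Thm. 5.16] -/
@[conjecture] def KimThree : Prop :=
  ∀ (W : WeierstrassCurve ℚ) [W.IsElliptic] [W.IsGloballyMinimal], KimRankZeroBoundAt W 3

/-- **Conjecture `KimThreeUnit` — "Kim 2026 Thm. 1.8 (1)+(6) remain valid at `p = 3`"** (unit
Kurihara number ⟹ `ord₃(L(E,1)/Ω) = ord₃ #Ш(E/ℚ)(3)`), every `E/ℚ`, tower binder:
`∀ W, KimRankZeroUnitBoundAt W 3`. ANNOUNCED (PRE, flag `Kim2025-preprint`): Kim–Pollack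
arXiv:2505.09121v1 Thm. 1.1 / Cor. 1.7 with a unit Kurihara number (then Ω_min ∼ Ω_E), on Sakamoto
JTNB 36 (2024) (PUB). OPEN in the tree; nothing asserted.
[cite: Kim2022StructureSelmer, Thm. 1.9 (1) and (6), §1.2.5] [cite: Sakamoto2022pSelmer, App. §5] -/
@[conjecture] def KimThreeUnit : Prop :=
  ∀ (W : WeierstrassCurve ℚ) [W.IsElliptic] [W.IsGloballyMinimal], KimRankZeroUnitBoundAt W 3

/-- **Conjecture X4♯(3)-Kim = THE N11 HYPOTHESIS in Kim's binder shape**: `KimThree` restricted to an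
ADDITIVE `3` (`Addv W 3`; with surj(3) — a binder of the predicate — this is exactly the class
`ClassX4 W 3`). Binder-by-binder against `Additive.X4SharpThree` (l. 240): SAME population except
(i) the tower binder (X4SharpThree also covers the `3`-adically EXOTIC surj(3) rows — Elkies'
three `j`-invariants, 20 curves with `N < 5·10⁵` — which the cell lists separately as the EXOTIC
residue), (ii) `L(E,1) ≠ 0 ∧ Ш finite` here vs `analyticRank = 0` there (equivalent under GZK +
modularity), (iii) conclusion `ord₃ #Ш(3) ≤ ord₃(L(E,1)/Ω)` here vs `ord₃ #Ш ≤ ord₃ #Ш_an + ord₃ ∏ c_ℓ`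
there (equivalent in rank `0`: `#Ш_an = L(E,1)·#tors²/(Ω ∏ c_ℓ)`, `3 ∤ #tors`); the kernel `iff` is
`x4SharpThreeKim_iff_x4SharpThree_tower` (sibling file). OPEN; nothing asserted. [folklore] -/
@[conjecture] def X4SharpThreeKim : Prop :=
  ∀ (W : WeierstrassCurve ℚ) [W.IsElliptic] [W.IsGloballyMinimal], Addv W 3 → KimRankZeroBoundAt W 3

/-- **Conjecture X4♯(3)-Kim-unit = the N11 hypothesis, unit-Kurihara EQUALITY shape**: `KimThreeUnit`
restricted to an additive `3`. Its per-pair use (sibling file): on an N11 row with `3 ∤ ∏ c_ℓ`, ONE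
unit Kurihara number at `3` gives `BSD(E,3)` — BOTH halves, so the LOWER rows (`3 ∣ #Ш_an`) become
certificate-shaped modulo this conjecture; on a row with `3 ∣ ∏ c_ℓ` where `BSD(E,3)` is known it
PREDICTS that no cyclic-level Kurihara number at `3` is a unit (falsifiable by the census). OPEN;
nothing asserted. [folklore] -/
@[conjecture] def X4SharpThreeKimUnit : Prop :=
  ∀ (W : WeierstrassCurve ℚ) [W.IsElliptic] [W.IsGloballyMinimal],
    Addv W 3 → KimRankZeroUnitBoundAt W 3

/-- `KimThree ⇒ X4SharpThreeKim` (restriction to the additive rows). Bookkeeping. [folklore] -/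
theorem x4SharpThreeKim_of_kimThree (h : KimThree) : X4SharpThreeKim :=
  fun W _ _ _ => h W

/-- `KimThreeUnit ⇒ X4SharpThreeKimUnit` (restriction to the additive rows). Bookkeeping. [folklore] -/
theorem x4SharpThreeKimUnit_of_kimThreeUnit (h : KimThreeUnit) : X4SharpThreeKimUnit :=
  fun W _ _ _ => h W

end Summit.BirchSwinnertonDyer.Rank1Residual.Additive

end
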